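import Literature.Analysis.FluidPDE.StationaryEulerTwoStateWave
import HarnessLib

/-!
# The two-state localized plane wave (Choffrut–Székelyhidi 2014, Lemma 4), II: measures and
assembly

Topic `Literature/Analysis/FluidPDE`. Support file of the proof of
`Literature.Analysis.FluidPDE.Torus.ChoffrutSzekelyhidi2014_thm1` (Choffrut–Székelyhidi, SIAM
J. Math. Anal. 46 (2014) = arXiv:1401.4301). Continuation of `StationaryEulerTwoStateWave.lean`:

* the level sets `A_r`, `A_l` of the two-state wave contain the preimages, under the Householder
  frame, of product sets `Πᵢ sᵢ` with `sᵢ = (1/q, 1 - 1/q)` for `i ≠ i₀` and `s_{i₀}` a disjoint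
  union of `M - 2n` intervals of length `(β₂ - α₂ - κ)/M` (resp. two families); hence
  `|A_r| ≥ (1 - 2/q)^d (β₂ - α₂ - κ) ≥ (1 - t) - 2ε_p - 2d/q` and
  `|A_l| ≥ (1 - 2/q)^d ((β₁ - α₁ - κ) + (β₃ - α₃ - κ)) ≥ t - 2ε_p - 2d/q`;
* **Lemma 4** (`exists_twoState`): for a certificate `w̄` with `|η| = 1`, a weight `t ∈ [0,1]`
  and `ε, δ > 0` there is a smooth potential supported in the reference cube whose field is
  `δ`-close to `{θ w̄ : θ ∈ [-(1-t), t]}` everywhere, equals `-(1-t) w̄` on an open set of measure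
  `≥ t - ε` and `t w̄` on a disjoint open set of measure `≥ (1-t) - ε`.

## References

* A. Choffrut, L. Székelyhidi Jr., SIAM J. Math. Anal. 46 (2014), Lemma 4.
-/

noncomputable section

open scoped InnerProductSpace ContDiff ENNReal
open Set Function MeasureTheory Metric
open Literature.Analysis.FunctionSpaces

namespace Literature.Analysis.FluidPDE

namespace StationaryEuler

variable {d : Type*} [Fintype d]

namespace TwoStateData

variable (D : TwoStateData d)

/-! ## Counting cells -/

/-- Bounds for cell indices: `n ≤ k` and `k + 1 ≤ M - n`. [folklore] -/
theorem mem_Kset {k : ℤ} (hk : k ∈ D.Kset) : (D.n : ℝ) ≤ k ∧ (k : ℝ) + 1 ≤ D.M - D.n := by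
  rw [Kset, Finset.mem_Icc] at hk
  constructor
  · exact_mod_cast hk.1
  · have : (k : ℝ) ≤ ((D.M : ℤ) - D.n - 1 : ℤ) := by exact_mod_cast hk.2
    push_cast at this; linarith

/-- `M ≥ 3n`, i.e. `M - 2n ≥ n ≥ 1`. [folklore] -/
theorem three_n_le_M : 3 * D.n ≤ D.M := by
  rw [M, mul_comm]; exact Nat.mul_le_mul_left D.n D.hq

/-- `#Kset = M - 2n`. [folklore] -/
theorem card_Kset : (D.Kset.card : ℝ) = D.M - 2 * D.n := by
  have h3 := D.three_n_le_M
  rw [Kset, Int.card_Icc]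
  have : ((D.M : ℤ) - D.n - 1 + 1 - D.n) = ((D.M - 2 * D.n : ℕ) : ℤ) := by omega
  rw [this, Int.toNat_natCast]
  push_cast [Nat.cast_sub (by omega : 2 * D.n ≤ D.M)]
  ring

/-- `#Kset / M = 1 - 2/q`. [folklore] -/
theorem card_Kset_div : (D.Kset.card : ℝ) / D.M = 1 - 2 / D.q := by
  rw [card_Kset, sub_div, div_self D.M_pos'.ne', mul_div_assoc, n_div_M]; ring

/-- `2/q ≤ 1`, hence `0 ≤ 1 - 2/q ≤ 1`. [folklore] -/
theorem one_sub_two_div_q_mem : 1 - 2 / (D.q : ℝ) ∈ Icc (0 : ℝ) 1 := by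
  have hq : (3 : ℝ) ≤ D.q := by exact_mod_cast D.hq
  constructor
  · rw [sub_nonneg, div_le_one (by linarith)]; linarith
  · have : 0 ≤ 2 / (D.q : ℝ) := by positivity
    linarith

/-! ## The slabs of the level sets -/

/-- The `k`-th slab interval of the window `[a, b]` in the phase variable:
`((k + a)/M, (k + b)/M)`. [folklore] -/
def slab (a b : ℝ) (k : ℤ) : Set ℝ := Ioo ((k + a) / D.M) ((k + b) / D.M)

/-- Slab intervals are measurable. [folklore] -/
theorem measurableSet_slab (a b : ℝ) (k : ℤ) : MeasurableSet (D.slab a b k) := measurableSet_Ioo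

/-- The volume of a slab interval. [folklore] -/
theorem volume_slab (a b : ℝ) (k : ℤ) : volume (D.slab a b k) = ENNReal.ofReal ((b - a) / D.M) := by
  rw [slab, Real.volume_Ioo]; congr 1; field_simp [D.M_pos'.ne']; ring

/-- Slabs of windows inside `[0,1]` with distinct indices are disjoint. [folklore] -/
theorem disjoint_slab {a b a' b' : ℝ} (ha : 0 ≤ a) (hb : b ≤ 1) (ha' : 0 ≤ a') (hb' : b' ≤ 1) {k k' : ℤ}
    (hkk' : k ≠ k') : Disjoint (D.slab a b k) (D.slab a' b' k') := by
  have hM := D.M_pos'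
  rw [Set.disjoint_left]
  intro u hu hu'
  simp only [slab, mem_Ioo, lt_div_iff₀ hM, div_lt_iff₀ hM] at hu hu'
  rcases lt_or_gt_of_ne hkk' with h | h
  · have : (k : ℝ) + 1 ≤ k' := by exact_mod_cast h
    linarith
  · have : (k' : ℝ) + 1 ≤ k := by exact_mod_cast h
    linarith

/-- Membership in a slab in terms of the rescaled phase. [folklore] -/
theorem mem_slab_iff {a b : ℝ} {k : ℤ} {u : ℝ} : u ∈ D.slab a b k ↔ D.M * u - k ∈ Ioo a b := by
  have hM := D.M_pos'
  simp only [slab, mem_Ioo, lt_div_iff₀ hM, div_lt_iff₀ hM]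
  constructor <;> rintro ⟨h1, h2⟩ <;> constructor <;> linarith

/-- Slabs with `k ∈ Kset` and windows in `(0,1)` lie in the plateau range `(1/q, 1 - 1/q)`. [folklore] -/
theorem slab_subset {a b : ℝ} (ha : 0 < a) (hb : b < 1) {k : ℤ} (hk : k ∈ D.Kset) :
    D.slab a b k ⊆ Ioo (1 / (D.q : ℝ)) (1 - 1 / D.q) := by
  have hM := D.M_pos'
  obtain ⟨hk1, hk2⟩ := D.mem_Kset hk
  have hq := D.n_div_M
  intro u hu
  rw [slab, mem_Ioo, lt_div_iff₀ hM, div_lt_iff₀ hM] at hu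
  rw [mem_Ioo, ← hq]
  constructor
  · rw [div_lt_iff₀ hM]; linarith
  · rw [lt_sub_iff_add_lt, add_div' _ _ _ hM.ne', div_lt_one hM]; linarith

/-- **Volume of the union of the slabs over `Kset`**: `(1 - 2/q)(b - a)`. [folklore] -/
theorem volume_biUnion_slab {a b : ℝ} (ha : 0 ≤ a) (hb : b ≤ 1) :
    volume (⋃ k ∈ D.Kset, D.slab a b k) = ENNReal.ofReal ((1 - 2 / D.q) * (b - a)) := by
  rw [measure_biUnion_finset (fun k _ k' _ h => D.disjoint_slab ha hb ha hb h)
    fun k _ => D.measurableSet_slab a b k]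
  simp only [volume_slab, Finset.sum_const, nsmul_eq_mul]
  rw [← ENNReal.ofReal_natCast, ← ENNReal.ofReal_mul (Nat.cast_nonneg _), ← card_Kset_div]
  congr 1
  field_simp

/-- Bernoulli: `(1 - 2/q)^d ≥ 1 - 2d/q`. [folklore] -/
theorem bernoulli : 1 - 2 * (Fintype.card d : ℝ) / D.q ≤ (1 - 2 / (D.q : ℝ)) ^ Fintype.card d := by
  have h := one_add_mul_le_pow (a := -(2 / (D.q : ℝ))) (by
    have : 2 / (D.q : ℝ) ≤ 1 := by linarith [D.one_sub_two_div_q_mem.1]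
    linarith) (Fintype.card d)
  calc 1 - 2 * (Fintype.card d : ℝ) / D.q = 1 + Fintype.card d * -(2 / (D.q : ℝ)) := by ring
    _ ≤ (1 + -(2 / (D.q : ℝ))) ^ Fintype.card d := h
    _ = (1 - 2 / (D.q : ℝ)) ^ Fintype.card d := by ring

/-! ## Product sets inside the level sets -/

variable [DecidableEq d]

/-- The product set with phase window `J` at `i₀` and plateau windows elsewhere. [folklore] -/
def prodSet (J : Set ℝ) : Set (d → ℝ) :=
  Set.pi univ fun i => if i = D.i₀ then J else Ioo (1 / (D.q : ℝ)) (1 - 1 / D.q)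

/-- Volume of the product set. [folklore] -/
theorem volume_prodSet (J : Set ℝ) :
    volume (D.prodSet J) = volume J * ENNReal.ofReal (1 - 2 / D.q) ^ (Fintype.card d - 1) := by
  rw [prodSet, volume_pi_pi]
  rw [← Finset.mul_prod_erase Finset.univ _ (Finset.mem_univ D.i₀), if_pos rfl]
  congr 1
  rw [Finset.prod_congr rfl fun i hi => by rw [if_neg (Finset.ne_of_mem_erase hi)], Finset.prod_const,
    Finset.card_erase_of_mem (Finset.mem_univ _), Finset.card_univ, Real.volume_Ioo]
  congr 2; ring

/-- The frame-coordinate map is measure preserving onto `d → ℝ`. [folklore] -/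
theorem measurePreserving_coord : MeasurePreserving (fun x : Ed d => (⇑(D.R x) : d → ℝ)) volume volume :=
  (PiLp.volume_preserving_ofLp d).comp D.R.measurePreserving

/-- **The positive product set lies in `A_r`.** [cite: ChoffrutSzekelyhidi2014, Lemma 4] -/
theorem preimage_prodSet_subset_Apos :
    (fun x : Ed d => (⇑(D.R x) : d → ℝ)) ⁻¹' D.prodSet (⋃ k ∈ D.Kset, D.slab (D.p.α₂ + D.p.κ) D.p.β₂ k) ⊆ D.Apos := by
  obtain ⟨hps1, hps2, hps3, hps4⟩ := D.p.plateaus_subset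
  have := D.p.α₁_pos; have := D.p.α₁_le_β₁; have := D.p.β₁_lt_α₂; have := D.p.α₂_le_β₂
  have := D.p.β₂_lt_α₃; have := D.p.α₃_le_β₃; have := D.p.β₃_add; have := D.p.κ_pos
  intro x hx
  simp only [mem_preimage, prodSet, mem_univ_pi] at hx
  have hx0 := hx D.i₀
  rw [if_pos rfl] at hx0
  obtain ⟨k, hk, hu⟩ := mem_iUnion₂.1 hx0
  refine ⟨fun i => ?_, mem_iUnion₂.2 ⟨k, hk, ?_⟩⟩
  · by_cases hi : i = D.i₀
    · subst hi; exact D.slab_subset (by linarith) (by linarith) hk hu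
    · have := hx i; rwa [if_neg hi] at this
  · exact D.mem_slab_iff.1 hu

/-- **The negative product set lies in `A_l`.** [cite: ChoffrutSzekelyhidi2014, Lemma 4] -/
theorem preimage_prodSet_subset_Aneg :
    (fun x : Ed d => (⇑(D.R x) : d → ℝ)) ⁻¹' D.prodSet ((⋃ k ∈ D.Kset, D.slab (D.p.α₁ + D.p.κ) D.p.β₁ k) ∪
      ⋃ k ∈ D.Kset, D.slab (D.p.α₃ + D.p.κ) D.p.β₃ k) ⊆ D.Aneg := by
  obtain ⟨hps1, hps2, hps3, hps4⟩ := D.p.plateaus_subset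
  have := D.p.α₁_pos; have := D.p.α₁_le_β₁; have := D.p.β₁_lt_α₂; have := D.p.α₂_le_β₂
  have := D.p.β₂_lt_α₃; have := D.p.α₃_le_β₃; have := D.p.β₃_add; have := D.p.κ_pos
  intro x hx
  simp only [mem_preimage, prodSet, mem_univ_pi] at hx
  have hx0 := hx D.i₀
  rw [if_pos rfl] at hx0
  have hother : ∀ i, i ≠ D.i₀ → D.R x i ∈ Ioo (1 / (D.q : ℝ)) (1 - 1 / D.q) := fun i hi => by
    have := hx i; rwa [if_neg hi] at this
  rcases hx0 with h | h
  · obtain ⟨k, hk, hu⟩ := mem_iUnion₂.1 h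
    refine ⟨fun i => ?_, mem_iUnion₂.2 ⟨k, hk, Or.inl (D.mem_slab_iff.1 hu)⟩⟩
    by_cases hi : i = D.i₀
    · subst hi; exact D.slab_subset (by linarith) (by linarith) hk hu
    · exact hother i hi
  · obtain ⟨k, hk, hu⟩ := mem_iUnion₂.1 h
    refine ⟨fun i => ?_, mem_iUnion₂.2 ⟨k, hk, Or.inr (D.mem_slab_iff.1 hu)⟩⟩
    by_cases hi : i = D.i₀
    · subst hi; exact D.slab_subset (by linarith) (by linarith) hk hu
    · exact hother i hi

/-! ## The measure bounds -/

/-- A real lower bound from a product set. [folklore] -/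
theorem volume_real_ge_of_prodSet {A : Set (Ed d)} (hA : A ⊆ refCube D.R) {J : Set ℝ} (hJ : MeasurableSet J)
    (hsub : (fun x : Ed d => (⇑(D.R x) : d → ℝ)) ⁻¹' D.prodSet J ⊆ A) {X : ℝ} (hX : 0 ≤ X)
    (hvol : volume J = ENNReal.ofReal ((1 - 2 / D.q) * X)) :
    (1 - 2 / (D.q : ℝ)) ^ Fintype.card d * X ≤ volume.real A := by
  have hq := D.one_sub_two_div_q_mem
  have hmeas : MeasurableSet (D.prodSet J) :=
    MeasurableSet.univ_pi fun i => by by_cases hi : i = D.i₀ <;> simp [hi, hJ, measurableSet_Ioo]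
  have h1 : volume ((fun x : Ed d => (⇑(D.R x) : d → ℝ)) ⁻¹' D.prodSet J) = volume (D.prodSet J) :=
    D.measurePreserving_coord.measure_preimage hmeas.nullMeasurableSet
  have hfin : volume A ≠ ⊤ :=
    ne_top_of_le_ne_top (by rw [volume_refCube]; exact ENNReal.one_ne_top) (measure_mono hA)
  have hcard : 1 ≤ Fintype.card d := Fintype.card_pos_iff.2 ⟨D.i₀⟩
  calc (1 - 2 / (D.q : ℝ)) ^ Fintype.card d * X
      = (volume (D.prodSet J)).toReal := by
        rw [D.volume_prodSet J, hvol, ENNReal.toReal_mul, ENNReal.toReal_pow, ENNReal.toReal_ofReal hq.1,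
          ENNReal.toReal_ofReal (mul_nonneg hq.1 hX)]
        conv_lhs => rw [← Nat.sub_add_cancel hcard, pow_succ]
        ring
    _ = (volume ((fun x : Ed d => (⇑(D.R x) : d → ℝ)) ⁻¹' D.prodSet J)).toReal := by rw [h1]
    _ ≤ volume.real A := ENNReal.toReal_mono hfin (measure_mono hsub)

/-- **Measure of the positive level set**: `|A_r| ≥ (1-t) - 2ε_p - 2d/q`.
[cite: ChoffrutSzekelyhidi2014, Lemma 4 (ii)] -/
theorem volume_real_Apos_ge : (1 - D.p.t) - 2 * D.p.ε - 2 * Fintype.card d / D.q ≤ volume.real D.Apos := by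
  obtain ⟨hps1, hps2, hps3, hps4⟩ := D.p.plateaus_subset
  have := D.p.α₁_pos; have := D.p.α₁_le_β₁; have := D.p.β₁_lt_α₂; have := D.p.α₂_le_β₂
  have := D.p.β₂_lt_α₃; have := D.p.α₃_le_β₃; have := D.p.β₃_add; have := D.p.κ_pos
  have hlen := D.p.length_pos
  have hq := D.one_sub_two_div_q_mem
  have hB := D.bernoulli
  set X := D.p.β₂ - (D.p.α₂ + D.p.κ) with hXdef
  have hX1 : X ≤ 1 := by linarith
  by_cases hX : 0 ≤ X
  · have h := D.volume_real_ge_of_prodSet D.Apos_subset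
      (MeasurableSet.biUnion D.Kset.countable_toSet fun k _ => D.measurableSet_slab _ _ k)
      D.preimage_prodSet_subset_Apos hX (D.volume_biUnion_slab (by linarith) (by linarith))
    have hcd : 0 ≤ 2 * (Fintype.card d : ℝ) / D.q := by positivity
    nlinarith [pow_le_one₀ hq.1 hq.2 (n := Fintype.card d)]
  · have h0 : 0 ≤ volume.real D.Apos := measureReal_nonneg
    have hcd : 0 ≤ 2 * (Fintype.card d : ℝ) / D.q := by positivity
    linarith

/-- **Measure of the negative level set**: `|A_l| ≥ t - 2ε_p - 2d/q`.
[cite: ChoffrutSzekelyhidi2014, Lemma 4 (ii)] -/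
theorem volume_real_Aneg_ge : D.p.t - 2 * D.p.ε - 2 * Fintype.card d / D.q ≤ volume.real D.Aneg := by
  obtain ⟨hps1, hps2, hps3, hps4⟩ := D.p.plateaus_subset
  have := D.p.α₁_pos; have := D.p.α₁_le_β₁; have := D.p.β₁_lt_α₂; have := D.p.α₂_le_β₂
  have := D.p.β₂_lt_α₃; have := D.p.α₃_le_β₃; have := D.p.β₃_add; have := D.p.κ_pos
  have hlen1 := D.p.length_neg₁
  have hlen3 := D.p.length_neg₃
  have hq := D.one_sub_two_div_q_mem
  have hB := D.bernoulli
  set X₁ := D.p.β₁ - (D.p.α₁ + D.p.κ) with hX₁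
  set X₃ := D.p.β₃ - (D.p.α₃ + D.p.κ) with hX₃
  have hX1 : X₁ + X₃ ≤ 1 := by linarith
  -- the length `L₁ - κ` is the same for both negative plateaus
  have hXeq : X₁ = X₃ := by
    simp only [hX₁, hX₃, Profile.CellData.β₁, Profile.CellData.β₃]; ring
  by_cases hX : 0 ≤ X₁
  · have hdisj : Disjoint (⋃ k ∈ D.Kset, D.slab (D.p.α₁ + D.p.κ) D.p.β₁ k)
        (⋃ k ∈ D.Kset, D.slab (D.p.α₃ + D.p.κ) D.p.β₃ k) := by
      rw [Set.disjoint_left]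
      intro u hu hu'
      obtain ⟨k, -, hk⟩ := mem_iUnion₂.1 hu
      obtain ⟨k', -, hk'⟩ := mem_iUnion₂.1 hu'
      rw [D.mem_slab_iff] at hk hk'
      have hM := D.M_pos'
      -- `M u - k ∈ (0,1)` and `M u - k' ∈ (0,1)` force `k = k'`, then the windows are disjoint
      have e1 : ⌊(D.M : ℝ) * u⌋ = k := by rw [Int.floor_eq_iff]; constructor <;> linarith [hk.1, hk.2]
      have e2 : ⌊(D.M : ℝ) * u⌋ = k' := by rw [Int.floor_eq_iff]; constructor <;> linarith [hk'.1, hk'.2]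
      have : k = k' := e1.symm.trans e2
      subst this
      linarith [hk.2, hk'.1]
    have hmeas₁ : MeasurableSet (⋃ k ∈ D.Kset, D.slab (D.p.α₁ + D.p.κ) D.p.β₁ k) :=
      MeasurableSet.biUnion D.Kset.countable_toSet fun k _ => D.measurableSet_slab _ _ k
    have hmeas₃ : MeasurableSet (⋃ k ∈ D.Kset, D.slab (D.p.α₃ + D.p.κ) D.p.β₃ k) :=
      MeasurableSet.biUnion D.Kset.countable_toSet fun k _ => D.measurableSet_slab _ _ k
    have hvol : volume ((⋃ k ∈ D.Kset, D.slab (D.p.α₁ + D.p.κ) D.p.β₁ k) ∪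
        ⋃ k ∈ D.Kset, D.slab (D.p.α₃ + D.p.κ) D.p.β₃ k) = ENNReal.ofReal ((1 - 2 / D.q) * (X₁ + X₃)) := by
      rw [measure_union hdisj hmeas₃, D.volume_biUnion_slab (by linarith) (by linarith),
        D.volume_biUnion_slab (by linarith) (by linarith), ← ENNReal.ofReal_add
        (mul_nonneg hq.1 hX) (mul_nonneg hq.1 (by linarith))]
      congr 1; ring
    have h := D.volume_real_ge_of_prodSet D.Aneg_subset (hmeas₁.union hmeas₃)
      D.preimage_prodSet_subset_Aneg (by linarith : 0 ≤ X₁ + X₃) hvol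
    have hcd : 0 ≤ 2 * (Fintype.card d : ℝ) / D.q := by positivity
    nlinarith [pow_le_one₀ hq.1 hq.2 (n := Fintype.card d)]
  · have h0 : 0 ≤ volume.real D.Aneg := measureReal_nonneg
    have hcd : 0 ≤ 2 * (Fintype.card d : ℝ) / D.q := by positivity
    linarith

end TwoStateData

/-! ## Lemma 4 -/

/-- The field of the zero potential vanishes. [folklore] -/
theorem WaveCert.field_zero [DecidableEq d] (c : WaveCert d) (x : Ed d) : c.field (fun _ => 0) x = 0 :=
  c.field_eq_zero_of_notMem (by simp)

/-- Uniform bounds for the first and second partial derivatives of a smooth compactly supported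
function. [folklore] -/
theorem exists_pd_bounds [DecidableEq d] {χ : Ed d → ℝ} (hχ : ContDiff ℝ ∞ χ) (hχc : HasCompactSupport χ) :
    ∃ M₁ M₂ : ℝ, (∀ k x, |pd (eb k) χ x| ≤ M₁) ∧ ∀ k l x, |pd (eb k) (pd (eb l) χ) x| ≤ M₂ := by
  have h1 : ∀ k, ∃ C, ∀ x, |pd (eb k) χ x| ≤ C := fun k => by
    obtain ⟨C, hC⟩ := (contDiff_pd hχ (eb k)).continuous.bounded_above_of_compact_support
      (hasCompactSupport_pd hχc _)
    exact ⟨C, fun x => by simpa [Real.norm_eq_abs] using hC x⟩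
  have h2 : ∀ k l, ∃ C, ∀ x, |pd (eb k) (pd (eb l) χ) x| ≤ C := fun k l => by
    obtain ⟨C, hC⟩ := (WaveCert.contDiff_pd_pd hχ (eb k) (eb l)).continuous.bounded_above_of_compact_support
      (hasCompactSupport_pd (hasCompactSupport_pd hχc _) _)
    exact ⟨C, fun x => by simpa [Real.norm_eq_abs] using hC x⟩
  choose C₁ hC₁ using h1
  choose C₂ hC₂ using h2
  refine ⟨∑ k, max (C₁ k) 0, ∑ k, ∑ l, max (C₂ k l) 0, fun k x => ?_, fun k l x => ?_⟩
  · exact ((hC₁ k x).trans (le_max_left _ _)).trans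
      (Finset.single_le_sum (fun j _ => le_max_right _ _) (Finset.mem_univ k))
  · refine ((hC₂ k l x).trans (le_max_left _ 0)).trans ?_
    calc max (C₂ k l) 0 ≤ ∑ l', max (C₂ k l') 0 :=
          Finset.single_le_sum (fun j _ => le_max_right _ _) (Finset.mem_univ l)
      _ ≤ ∑ k', ∑ l', max (C₂ k' l') 0 :=
          Finset.single_le_sum (f := fun k' => ∑ l', max (C₂ k' l') 0)
            (fun j _ => Finset.sum_nonneg fun i _ => le_max_right _ _) (Finset.mem_univ k)

/-- **Lemma 4 (two-state localized plane wave).** Let `w̄` be a certified wave direction with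
unit `η`, `i₀` a coordinate, `t ∈ [0, 1]` and `ε, δ > 0`. There is a smooth potential `φ`
supported in the reference cube `B` of the Householder frame of `η` such that the subsolution
`W = 𝓛_w̄[φ]` satisfies: (i) for every `x` there is `θ ∈ [-(1-t), t]` with
`‖W(x) - θ w̄‖ ≤ δ` (values `δ`-close to the segment `[-(1-t) w̄, t w̄]`); (ii) there are disjoint
open subsets `A_l, A_r ⊆ B` with `W = -(1-t) w̄` on `A_l`, `W = t w̄` on `A_r`,
`|A_l| ≥ t - ε`, `|A_r| ≥ (1 - t) - ε` (`|B| = 1`).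
[cite: ChoffrutSzekelyhidi2014, Lemma 4] -/
theorem exists_twoState [DecidableEq d] (c : WaveCert d) (hη : ‖c.η‖ = 1) (i₀ : d) {t : ℝ} (ht0 : 0 ≤ t)
    (ht1 : t ≤ 1) {ε δ : ℝ} (hε : 0 < ε) (hδ : 0 < δ) :
    ∃ φ : Ed d → ℝ, ContDiff ℝ ∞ φ ∧ HasCompactSupport φ ∧ tsupport φ ⊆ refCube (houseR i₀ c.η) ∧
      (∀ x, ∃ θ ∈ Icc (-(1 - t)) t, ‖c.field φ x - θ • c.dir‖ ≤ δ) ∧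
      ∃ Al Ar : Set (Ed d), IsOpen Al ∧ IsOpen Ar ∧ Al ⊆ refCube (houseR i₀ c.η) ∧
        Ar ⊆ refCube (houseR i₀ c.η) ∧ Disjoint Al Ar ∧
        (∀ x ∈ Al, c.field φ x = (-(1 - t)) • c.dir) ∧ (∀ x ∈ Ar, c.field φ x = t • c.dir) ∧
        t - ε ≤ volume.real Al ∧ (1 - t) - ε ≤ volume.real Ar := by
  haveI : Nonempty d := ⟨i₀⟩
  have hvolB : volume.real (refCube (houseR i₀ c.η)) = 1 := by
    rw [Measure.real, volume_refCube, ENNReal.toReal_one]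
  -- the degenerate weights
  rcases ht0.eq_or_lt with rfl | ht0'
  · refine ⟨fun _ => 0, contDiff_const, HasCompactSupport.zero, by simp, fun x => ⟨0, by simp, ?_⟩,
      ∅, refCube (houseR i₀ c.η), isOpen_empty, isOpen_refCube _, empty_subset _, subset_rfl,
      empty_disjoint _, fun x hx => hx.elim, fun x _ => ?_, by simp [hε.le], by rw [hvolB]; linarith⟩
    · rw [c.field_zero, zero_smul, sub_zero, norm_zero]; exact hδ.le
    · rw [c.field_zero, zero_smul]
  rcases ht1.eq_or_lt with rfl | ht1'
  · refine ⟨fun _ => 0, contDiff_const, HasCompactSupport.zero, by simp, fun x => ⟨0, by simp, ?_⟩,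
      refCube (houseR i₀ c.η), ∅, isOpen_refCube _, isOpen_empty, subset_rfl, empty_subset _,
      disjoint_empty _, fun x _ => ?_, fun x hx => hx.elim, by rw [hvolB]; linarith, by simp [hε.le]⟩
    · rw [c.field_zero, zero_smul, sub_zero, norm_zero]; exact hδ.le
    · rw [c.field_zero, sub_self, neg_zero, zero_smul]
  -- the parameters: waste `ε' = min (ε/4) (1/2)`, cutoff `q ≥ max 3 (4d/ε)`
  set ε' : ℝ := min (ε / 4) (1 / 2) with hε'
  have hε'0 : 0 < ε' := lt_min (by linarith) (by norm_num)
  have hε'1 : ε' < 1 := (min_le_right _ _).trans_lt (by norm_num)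
  have hε'4 : ε' ≤ ε / 4 := min_le_left _ _
  set p : Profile.CellData := ⟨t, ε', ht0', ht1', hε'0, hε'1⟩ with hp
  obtain ⟨q, hq⟩ := exists_nat_gt (max (3 : ℝ) (4 * Fintype.card d / ε))
  have hq3 : 3 ≤ q := by exact_mod_cast ((le_max_left _ _).trans hq.le)
  have hq3' : (3 : ℝ) ≤ q := by exact_mod_cast hq3
  have hqpos : (0 : ℝ) < q := by linarith
  have hqε : 2 * (Fintype.card d : ℝ) / q ≤ ε / 2 := by
    have h := (le_max_right _ _).trans_lt hq
    rw [div_lt_iff₀ hε] at h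
    rw [div_le_iff₀ hqpos]
    nlinarith
  -- the cutoff and the profile do not depend on `n`: bounds first, then `n`
  set D₀ : TwoStateData d := ⟨c, hη, i₀, p, q, hq3, 1, le_rfl⟩ with hD₀
  obtain ⟨M₁, M₂, hM₁, hM₂⟩ := exists_pd_bounds D₀.contDiff_χ D₀.hasCompactSupport_χ
  obtain ⟨K, hK0, hK⟩ := p.exists_bound
  have hM₁0 : 0 ≤ M₁ := (abs_nonneg _).trans (hM₁ i₀ 0)
  have hM₂0 : 0 ≤ M₂ := (abs_nonneg _).trans (hM₂ i₀ i₀ 0)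
  set Cb : ℝ := c.coefBound * (M₂ * K + 2 * M₁ * K) with hCb
  have hcoef : 0 ≤ c.coefBound := by
    unfold WaveCert.coefBound
    exact add_nonneg (Finset.sum_nonneg fun _ _ => Finset.sum_nonneg fun _ _ => Finset.sum_nonneg
      fun _ _ => abs_nonneg _) (Finset.sum_nonneg fun _ _ => Finset.sum_nonneg fun _ _ =>
      Finset.sum_nonneg fun _ _ => Finset.sum_nonneg fun _ _ => abs_nonneg _)
  have hCb0 : 0 ≤ Cb := by positivity
  obtain ⟨n, hn⟩ := exists_nat_gt (max (1 : ℝ) (Cb / δ))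
  have hn1 : 1 ≤ n := by exact_mod_cast ((le_max_left _ _).trans hn.le)
  set D : TwoStateData d := ⟨c, hη, i₀, p, q, hq3, n, hn1⟩ with hD
  have hχ : D.χ = D₀.χ := rfl
  have hMn : (n : ℝ) ≤ D.M := by
    have : D.M = n * q := rfl
    rw [this, Nat.cast_mul]
    have : (1 : ℝ) ≤ q := by linarith
    nlinarith [(Nat.cast_nonneg n : (0 : ℝ) ≤ n)]
  have hM1 : (1 : ℝ) ≤ D.M := le_trans (by exact_mod_cast hn1) hMn
  have hMpos : (0 : ℝ) < D.M := by linarith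
  -- the remainder bound
  have hrem : ∀ x, ‖c.rem D.χ D.comb x‖ ≤ δ := by
    intro x
    have h := D.norm_rem_le (M₁ := M₁) (M₂ := M₂) (K := K) (by rw [hχ]; exact hM₁) (by rw [hχ]; exact hM₂) hK0 hK x
    have hKM : K / (D.M : ℝ) ^ 2 ≤ K / D.M :=
      div_le_div_of_nonneg_left hK0 hMpos (by nlinarith)
    have hb : c.coefBound * (M₂ * (K / (D.M : ℝ) ^ 2) + 2 * (M₁ * 1) * (K / D.M)) ≤ Cb / D.M := by
      rw [hCb]
      have : c.coefBound * (M₂ * (K / (D.M : ℝ)) + 2 * (M₁ * 1) * (K / D.M)) =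
          c.coefBound * (M₂ * K + 2 * M₁ * K) / D.M := by field_simp
      rw [← this]
      gcongr
    have hn' : Cb / δ < D.M := ((le_max_right _ _).trans_lt hn).trans_le hMn
    have hfin : Cb / (D.M : ℝ) ≤ δ := by
      rw [div_le_iff₀ hMpos]; rw [div_lt_iff₀ hδ] at hn'; linarith
    exact (h.trans hb).trans hfin
  refine ⟨D.pot, D.contDiff_pot, D.hasCompactSupport_pot, D.tsupport_pot_subset, fun x => ?_,
    D.Aneg, D.Apos, D.isOpen_Aneg, D.isOpen_Apos, D.Aneg_subset, D.Apos_subset, D.disjoint_Aneg_Apos,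
    fun x hx => D.W_eq_neg hx, fun x hx => D.W_eq_pos hx, ?_, ?_⟩
  · refine ⟨D.χ x * D.comb'' (phase c.η x), D.amp_mem_Icc x, ?_⟩
    have := D.W_eq x
    rw [TwoStateData.W] at this
    rw [this, add_sub_cancel_left]
    exact hrem x
  · have h := D.volume_real_Aneg_ge
    have : D.p.t = t := rfl
    have : D.p.ε = ε' := rfl
    have : (D.q : ℝ) = q := rfl
    linarith
  · have h := D.volume_real_Apos_ge
    have : D.p.t = t := rfl
    have : D.p.ε = ε' := rfl
    have : (D.q : ℝ) = q := rfl
    linarith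

end StationaryEuler

end Literature.Analysis.FluidPDE
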